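import Literature.NumberTheory.Automorphic.ShimuraCurveRibetTakahashiPeterssonTwoPowerLevelProofs
import Literature.NumberTheory.ModularForms.OrdinaryCuspsFrobeniusHecke
import Mathlib.NumberTheory.LSeries.PrimesInAP
import Mathlib.Data.Nat.ChineseRemainder
import HarnessLib

/-!
# Route `AdditiveKolyvaginRoad`, crux `ManinFrameResidueProperR` (stmt-BirchSwinnertonDyer-20709), line
# `birth`, stub TDS: `Γ₀(N)`-bookkeeping for the TAME-TWIST lever — `--supports`, helper

Cell `pub/bsd-wall`, seat `bsd-wall-manin-p1` g3. Pure `SL(2, ℤ)` arithmetic (no modular forms), consumed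
by `…ManinFrameResidueProperRTameTwist.lean`. For `γ = (a b; c d) ∈ Γ₀(N)` and a prime `p ∣ N`, `γ` is
**adjustable** (spelled out in each statement) if `c ≠ 0`, `d ≢ 1 (mod p)`, and `d ≢ 1 (mod r)` for every
odd prime `r ∣ p − 1` dividing `c`. §1 `exists_prime_eq_add_mul_of_adjustable`: an adjustable `γ` has a
PRIME `d′ = d + kc > N` with `p ∤ d′ − 1`, `r ∤ d′ − 1` (Dirichlet, Mathlib `Nat.forall_exists_prime_gt_…`).
The splitting `γ⁴ = γ₁ γ₂` into adjustable elements is in the sibling `…RTameTwistSplit.lean`. Everything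
proved; no definition.
-/

set_option autoImplicit false
set_option linter.dupNamespace false

noncomputable section

open scoped MatrixGroups Classical

open CongruenceSubgroup Matrix

namespace Summit.BirchSwinnertonDyer.BirchSwinnertonDyer.Theorems.ManinFrameResidueProperRTameTwist

/-! ### §0 Entries of `Γ₀(N)`-elements (plumbing) -/

section Entries

variable {N : ℕ}

/-- The lower-left entry of `γ ∈ Γ₀(N)` is divisible by `N`. [folklore] -/
theorem natCast_dvd_entry10 (γ : Gamma0 N) : (N : ℤ) ∣ (γ : SL(2, ℤ)) 1 0 := by
  have h := Gamma0_mem.mp γ.2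
  exact (ZMod.intCast_zmod_eq_zero_iff_dvd _ N).mp (by exact_mod_cast h)

/-- `a d − b c = 1` for `γ ∈ Γ₀(N)` (plumbing). [folklore] -/
theorem entry_det (γ : Gamma0 N) :
    (γ : SL(2, ℤ)) 0 0 * (γ : SL(2, ℤ)) 1 1 - (γ : SL(2, ℤ)) 0 1 * (γ : SL(2, ℤ)) 1 0 = 1 := by
  have := Matrix.det_fin_two (γ : SL(2, ℤ)).1
  rw [(γ : SL(2, ℤ)).2] at this
  linear_combination -this

/-- Entries of `γ T^k = (a, ak + b; c, ck + d)`. [folklore] -/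
theorem entries_mul_T_zpow (γ : SL(2, ℤ)) (k : ℤ) :
    (γ * ModularGroup.T ^ k) 0 0 = γ 0 0 ∧ (γ * ModularGroup.T ^ k) 1 0 = γ 1 0 ∧
      (γ * ModularGroup.T ^ k) 0 1 = γ 0 0 * k + γ 0 1 ∧
      (γ * ModularGroup.T ^ k) 1 1 = γ 1 0 * k + γ 1 1 := by
  have h : ∀ i j : Fin 2, (γ * ModularGroup.T ^ k) i j =
      ((γ : Matrix (Fin 2) (Fin 2) ℤ) * (ModularGroup.T ^ k).1) i j := fun _ _ ↦ rfl
  simp only [h, ModularGroup.coe_T_zpow, Matrix.mul_apply, Fin.sum_univ_two, Matrix.of_apply,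
    Matrix.cons_val', Matrix.cons_val_zero, Matrix.cons_val_one, Matrix.empty_val',
    Matrix.cons_val_fin_one, mul_one, mul_zero, add_zero]
  exact ⟨trivial, trivial, trivial, trivial⟩

end Entries

/-! ### §1 A prime denominator in the class of `d` modulo `c`, avoiding `1` modulo `p` and modulo the
odd primes of `p − 1` -/

section PrimeDenominator

variable {N : ℕ} {p : ℕ}

/-- **Dirichlet step.** An adjustable `γ = (a b; c d) ∈ Γ₀(N)` (`p ∣ N` prime) has `k ∈ ℤ` and a
prime `d′ = d + kc > N` with `p ∤ d′ − 1` and `r ∤ d′ − 1` for every odd prime `r ∣ p − 1`: Dirichlet's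
theorem in the class `x (mod cR)`, `x ≡ d (c)`, `x ≡ 2 (R)`, `R` = product of the odd primes of `p − 1`
not dividing `c`. [folklore] -/
theorem exists_prime_eq_add_mul_of_adjustable (hp : p.Prime) (hpN : p ∣ N) (γ : Gamma0 N)
    (hc : (γ : SL(2, ℤ)) 1 0 ≠ 0) (hdp : ¬ (p : ℤ) ∣ (γ : SL(2, ℤ)) 1 1 - 1)
    (hdr : ∀ r : ℕ, r.Prime → r ≠ 2 → r ∣ p - 1 → (r : ℤ) ∣ (γ : SL(2, ℤ)) 1 0 →
      ¬ (r : ℤ) ∣ (γ : SL(2, ℤ)) 1 1 - 1) :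
    ∃ (k : ℤ) (d' : ℕ), d'.Prime ∧ N < d' ∧ ((d' : ℤ) = (γ : SL(2, ℤ)) 1 1 + k * (γ : SL(2, ℤ)) 1 0) ∧
      ¬ p ∣ d' - 1 ∧ ∀ r : ℕ, r.Prime → r ≠ 2 → r ∣ p - 1 → ¬ r ∣ d' - 1 := by
  set c : ℤ := (γ : SL(2, ℤ)) 1 0 with hcdef
  set d : ℤ := (γ : SL(2, ℤ)) 1 1 with hddef
  -- `gcd(c, d) = 1`
  have hcop : IsCoprime d c := by
    refine ⟨(γ : SL(2, ℤ)) 0 0, -((γ : SL(2, ℤ)) 0 1), ?_⟩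
    have := entry_det γ
    linear_combination this
  -- the auxiliary modulus `R = ∏ (odd primes r ∣ p − 1, r ∤ c)`
  set P : Finset ℕ := ((p - 1).primeFactors.erase 2).filter (fun r ↦ ¬ (r : ℤ) ∣ c) with hPdef
  obtain ⟨R, hRdef⟩ : ∃ R : ℕ, R = ∏ r ∈ P, r := ⟨_, rfl⟩
  have hPprime : ∀ r ∈ P, r.Prime := fun r hr ↦
    Nat.prime_of_mem_primeFactors (Finset.mem_of_mem_erase (Finset.mem_filter.mp hr).1)
  have hPndvd : ∀ r ∈ P, ¬ (r : ℤ) ∣ c := fun r hr ↦ (Finset.mem_filter.mp hr).2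
  have hPne2 : ∀ r ∈ P, r ≠ 2 := fun r hr ↦ Finset.ne_of_mem_erase (Finset.mem_filter.mp hr).1
  have hRc : IsCoprime (R : ℤ) c := by
    rw [hRdef, Nat.cast_prod]
    exact IsCoprime.prod_left fun r hr ↦
      Literature.NumberTheory.ModularForms.OrdinaryCusps.isCoprime_natCast_of_not_dvd (hPprime r hr) (hPndvd r hr)
  have hR2 : ¬ (2 : ℤ) ∣ R := by
    rw [hRdef, Nat.cast_prod]
    intro h
    obtain ⟨r, hr, h2r⟩ := (Prime.dvd_finsetProd_iff Int.prime_two _).mp h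
    have h2r' : (2 : ℕ) ∣ r := by exact_mod_cast h2r
    exact hPne2 r hr (((hPprime r hr).eq_one_or_self_of_dvd 2 h2r').resolve_left (by norm_num)).symm
  have hR0 : R ≠ 0 := by
    rw [hRdef]; exact Finset.prod_ne_zero_iff.mpr fun r hr ↦ (hPprime r hr).ne_zero
  -- Bezout for `(R, c)` and the target class `x ≡ d (mod c)`, `x ≡ 2 (mod R)`
  obtain ⟨u, v, huv⟩ := hRc
  obtain ⟨x, hxdef⟩ : ∃ x : ℤ, x = d * u * R + 2 * v * c := ⟨_, rfl⟩
  have hu : IsCoprime u c := ⟨R, v, by linear_combination huv⟩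
  have hRc' : IsCoprime (R : ℤ) c := ⟨u, v, huv⟩
  have hxc : IsCoprime x c := by
    have h1 : IsCoprime (d * u * R) c := (hcop.mul_left hu).mul_left hRc'
    rw [hxdef, show d * u * R + 2 * v * c = d * u * R + c * (2 * v) by ring]
    exact h1.add_mul_left_left (2 * v)
  have hxR : IsCoprime x R := by
    have h2 : IsCoprime (2 : ℤ) R :=
      Literature.NumberTheory.ModularForms.OrdinaryCusps.isCoprime_natCast_of_not_dvd Nat.prime_two hR2
    have hv : IsCoprime v (R : ℤ) := ⟨c, u, by linear_combination huv⟩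
    have hcR : IsCoprime c (R : ℤ) := ⟨v, u, by linear_combination huv⟩
    have h3 : IsCoprime (2 * v * c) (R : ℤ) := (h2.mul_left hv).mul_left hcR
    rw [hxdef, show d * u * R + 2 * v * c = 2 * v * c + R * (d * u) by ring]
    exact h3.add_mul_left_left (d * u)
  have hq0 : (c * R).natAbs ≠ 0 := by
    rw [Int.natAbs_ne_zero]
    exact mul_ne_zero hc (by exact_mod_cast hR0)
  have hxq : IsCoprime x ((c * R).natAbs : ℤ) := by
    rw [Int.natCast_natAbs]
    rcases abs_choice (c * R) with h | h <;> rw [h]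
    · exact hxc.mul_right hxR
    · exact (hxc.mul_right hxR).neg_right
  obtain ⟨d', hd'N, hd'p, hd'x⟩ := Nat.forall_exists_prime_gt_and_zmodEq N hq0 hxq
  -- `d′ ≡ x ≡ d (mod c)` and `d′ ≡ x ≡ 2 (mod r)` for `r ∈ P`
  have hmodq : c * R ∣ x - d' := by
    have h := hd'x.dvd
    rwa [Int.natCast_natAbs, abs_dvd] at h
  have hmodc : c ∣ x - d' := (dvd_mul_right c R).trans hmodq
  have hmodR : (R : ℤ) ∣ x - d' := (dvd_mul_left (R : ℤ) c).trans hmodq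
  have hxd : c ∣ x - d := ⟨v * (2 - d), by rw [hxdef]; linear_combination d * huv⟩
  obtain ⟨k, hk⟩ : c ∣ d' - d := by
    rw [show (d' : ℤ) - d = (x - d) - (x - d') by ring]
    exact dvd_sub hxd hmodc
  have hcast : ((d' - 1 : ℕ) : ℤ) = (d' : ℤ) - 1 := by
    rw [Nat.cast_sub hd'p.one_lt.le, Nat.cast_one]
  refine ⟨k, d', hd'p, hd'N, by linear_combination hk, ?_, ?_⟩
  · -- `p ∤ d′ − 1`: `p ∣ c`, `d′ ≡ d (mod c)`, `d ≢ 1 (mod p)`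
    intro h
    have hpc : (p : ℤ) ∣ c := (Int.natCast_dvd_natCast.mpr hpN).trans (natCast_dvd_entry10 γ)
    have h1 : (p : ℤ) ∣ (d' : ℤ) - 1 := by rw [← hcast]; exact_mod_cast h
    apply hdp
    rw [show d - 1 = ((d' : ℤ) - 1) - (d' - d) by ring]
    exact dvd_sub h1 (hpc.trans ⟨k, hk⟩)
  · intro r hr hr2 hrp h
    have h1 : (r : ℤ) ∣ (d' : ℤ) - 1 := by rw [← hcast]; exact_mod_cast h
    by_cases hrc : (r : ℤ) ∣ c
    · -- `r ∣ c`: `d′ ≡ d (mod r)` and adjustability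
      apply hdr r hr hr2 hrp hrc
      rw [show d - 1 = ((d' : ℤ) - 1) - (d' - d) by ring]
      exact dvd_sub h1 (hrc.trans ⟨k, hk⟩)
    · -- `r ∤ c`: `r ∈ P`, `d′ ≡ x ≡ 2 (mod r)`, so `r ∣ 1`
      have hrP : r ∈ P := by
        rw [hPdef, Finset.mem_filter]
        refine ⟨Finset.mem_erase.mpr ⟨hr2, ?_⟩, hrc⟩
        exact Nat.mem_primeFactors.mpr ⟨hr, hrp, Nat.sub_ne_zero_of_lt hp.one_lt⟩
      have hrR : (r : ℤ) ∣ R := by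
        rw [hRdef, Nat.cast_prod]; exact Finset.dvd_prod_of_mem _ hrP
      have hx2 : (r : ℤ) ∣ x - 2 := by
        rw [show x - 2 = (R : ℤ) * (u * (d - 2)) by rw [hxdef]; linear_combination (2 : ℤ) * huv]
        exact hrR.trans (dvd_mul_right _ _)
      have h3 : (r : ℤ) ∣ (x - 2) - (x - d') - ((d' : ℤ) - 1) :=
        dvd_sub (dvd_sub hx2 (hrR.trans hmodR)) h1
      rw [show (x - 2) - (x - d') - ((d' : ℤ) - 1) = -1 by ring, dvd_neg] at h3
      have := Int.eq_one_of_dvd_one (Int.natCast_nonneg r) h3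
      exact hr.one_lt.ne' (by exact_mod_cast this)

end PrimeDenominator

end Summit.BirchSwinnertonDyer.BirchSwinnertonDyer.Theorems.ManinFrameResidueProperRTameTwist

end
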